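import Summits.QuantumFields.YangMills.Theorems.UnitScaleTiltProp7LineIterVsEngine
import Summits.QuantumFields.YangMills.Theorems.UnitScaleTiltProp7LineIterRepr
import HarnessLib

/-!
# Route `UnitScaleTilt`, crux K1 «MinimiserStabilityRegPr» (stmt-QuantumFields-19200), route-R [RP] curved, the curved N6 row (R-C) — THE PLUMBING:
# the pure `LINE`-iterate of a level-0 field along the (0.4)-tower of a background with GEOMETRIC per-level loop sizes `a_j ≤ C_a·ε·L^{2j}/L^{2k}` differs from the
# engine's covariant straight-line block functional by `O(ε + L^{2k}δ)` in `ℓ²`, k-UNIFORMLY: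
# `Σ_c‖S_k(c) − (L^k)^{−d}Ad_{g_c}A^{U₀}_cY‖² ≤ ((2E·ε + ((4d+5)L^k)²/2·δ)·(L^k)^{−d})²·((L^k)^d L^k)L^k·Σ_b‖Y_b‖²`, `E = 2(d+2)C_a/((L−1)(L²−1))·L`

Cell `ym3-torus`, width seat `ym-ust-20520-w2` (g3).  The plumbing step of the memo `RC-TRANSPORT-GEOMETRY-w2g3.md` §2′: the dominating recursion families `θ, η, len, H` of
✓ p611449 `exists_lineIter_repr` are instantiated (inside the proof, by `Nat.rec`; no definitions) and bounded in closed form for geometric level sizes, the pure family `S`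
is shown to exist, and ✓ p612463 `sum_normSq_lineIter_sub_engine_le` is applied.  THEOREMS ONLY (0 `def`, 0 `sorry`); `--supports stmt-QuantumFields-19200`, count-neutral.
YM₃ on T³ is a ladder rung (R3), not the Clay problem; nothing here claims S2, P, the crux or the gap.

WHAT IS PROVED (ns `…Theorems.Prop7LineIterVsEngineOfTower`).
* §1 `exists_pureLine_family` — the pure `LINE` recursion family along the tower exists (`Nat.rec`).
* §2 `theta_bound`, `eta_bound`, `len_bound` — closed-form bounds of the dominating recursions for geometric sizes (`θ_j ≤ Dεx_j`, `η_j ≤ Eεx_j`, `len_j ≤ 2(d+2)L^j`,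
  `x_j = L^{2j}/L^{2k}`, `D = 2C_a/(L(L−1))`, `E = (d+2)L·D/(L²−1)`).
* §3 ★★★ `sum_normSq_lineIter_sub_engine_le_of_tower` — the title row, hypotheses: `k ≤ m+K`, per-level loop sizes in geometric form, `C_aε ≤ 1/6`, `C_aε < δ_N`, `PlaqSmall δ U₀`.
HONEST SCOPE.  With ✓ p608741 (`G_k − S_k`) and ✓ p606268 (`‖G_k(c)‖ ≤ ‖QkYc‖ + ‖Λc₋‖ + ‖Λc₊‖`) this is every curved-N6 ingredient of `hA`∕`hE` of ✓ p601741; the three-term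
Minkowski and the reading `c_E` := explicit numeral are left to the S2′ knit (whose `Q k Y` budget is ★routeR-w3's and whose `Λ` bound is ★routeR-w2's (R-B)).

References: T. Bałaban, CMP 99 (1985) 389–434 [Balaban1985BackgroundPropagators] (Thm 3.11 p.416); CMP 95 (1984) 17–40 [Balaban1984PropagatorsI] ((1.18) p.20).
-/

noncomputable section

open scoped BigOperators Matrix.Norms.L2Operator

namespace Summit.QuantumFields.YangMills.Theorems.Prop7LineIterVsEngineOfTower

open Literature.MathematicalPhysics.QuantumFieldTheory.Balaban1983to89
open Finset T4Continuum T4ReflectionCone BlockAveraging AveragingRT ExpMeanLog BlockAveragingEMLLinearised BlockAveragingEMLLinearisedBackground B1RG242Torus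
open B15DeterminingSets (embIter)
open B7Prop1Explicit (treeWord)
open B7Eq78Linearization (conjR)
open B10Eq27TorusAxialLog (holT unitsField toUField)
open Summit.QuantumFields.YangMills.Theorems.Prop7LineIterRepr (exists_lineIter_repr)
open Summit.QuantumFields.YangMills.Theorems.Prop7LineIterVsEngine (sum_normSq_lineIter_sub_engine_le H_eq_halfPow)
open Summit.QuantumFields.YangMills.Theorems.ChartHInv (half_pow_succ_sub_one)

variable {P : Params} {n : ℕ} [NeZero n]

/-! ## §1 The pure `LINE` recursion family exists -/

/-- The pure `LINE` recursion family along the tower (`S 0 = Y`, `S (j+1) c = LINE_{Ū₀^{(j)}}(S j)(c)`) exists (`Nat.rec`). [folklore] -/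
theorem exists_pureLine_family (U₀ : GaugeField P 0 (Matrix.specialUnitaryGroup (Fin n) ℂ)) (Y : PBond P 0 → Matrix (Fin n) (Fin n) ℂ) :
    ∃ S : (k : ℕ) → PBond P k → Matrix (Fin n) (Fin n) ℂ, (∀ b, S 0 b = Y b) ∧
      ∀ (k : ℕ) (c : PBond P (k + 1)), S (k + 1) c
        = ((Fintype.card (Idx P) : ℂ))⁻¹ • ∑ i : Idx P,
            ((holAt (Averaging.iter (fun i => blockAvg (P := P) (j := i) (expMeanLogSU (n := Fin n))) k U₀) (walk (emb c.src) (stairWord i.2.1 (off i.1))) :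
                Matrix.specialUnitaryGroup (Fin n) ℂ) : Matrix (Fin n) (Fin n) ℂ) *
              covWalkSum (Averaging.iter (fun i => blockAvg (P := P) (j := i) (expMeanLogSU (n := Fin n))) k U₀) (S k)
                (walk (walkEnd (emb c.src) (stairWord i.2.1 (off i.1))) (List.replicate P.L (c.dir, true))) *
            star ((holAt (Averaging.iter (fun i => blockAvg (P := P) (j := i) (expMeanLogSU (n := Fin n))) k U₀) (walk (emb c.src) (stairWord i.2.1 (off i.1))) :
                Matrix.specialUnitaryGroup (Fin n) ℂ) : Matrix (Fin n) (Fin n) ℂ) := by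
  refine ⟨fun k => Nat.rec (motive := fun k => PBond P k → Matrix (Fin n) (Fin n) ℂ) Y (fun k Sk => fun c =>
      ((Fintype.card (Idx P) : ℂ))⁻¹ • ∑ i : Idx P,
        ((holAt (Averaging.iter (fun i => blockAvg (P := P) (j := i) (expMeanLogSU (n := Fin n))) k U₀) (walk (emb c.src) (stairWord i.2.1 (off i.1))) :
            Matrix.specialUnitaryGroup (Fin n) ℂ) : Matrix (Fin n) (Fin n) ℂ) *
          covWalkSum (Averaging.iter (fun i => blockAvg (P := P) (j := i) (expMeanLogSU (n := Fin n))) k U₀) Sk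
            (walk (walkEnd (emb c.src) (stairWord i.2.1 (off i.1))) (List.replicate P.L (c.dir, true))) *
        star ((holAt (Averaging.iter (fun i => blockAvg (P := P) (j := i) (expMeanLogSU (n := Fin n))) k U₀) (walk (emb c.src) (stairWord i.2.1 (off i.1))) :
            Matrix.specialUnitaryGroup (Fin n) ℂ) : Matrix (Fin n) (Fin n) ℂ)) k, fun _ => rfl, fun _ _ => rfl⟩

/-! ## §2 Closed-form bounds of the dominating recursions for geometric level sizes -/

omit [NeZero n] in
/-- `θ_0 = 0`, `θ_{j+1} = 2a_j + Lθ_j`, `a_j ≤ C_aεx_j`, `x_{j+1} = L²x_j` ⇒ `θ_j ≤ D·ε·x_j` with `D = 2C_a/(L(L−1))`. [folklore] -/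
theorem theta_bound {L Ca ε : ℝ} (hL : 2 ≤ L) (hCa : 0 ≤ Ca) (hε : 0 ≤ ε) (a x θ : ℕ → ℝ) (hx0 : ∀ j, 0 ≤ x j) (hx : ∀ j, x (j + 1) = L ^ 2 * x j)
    (ha : ∀ j, a j ≤ Ca * ε * x j) (hθ0 : θ 0 = 0) (hθ : ∀ j, θ (j + 1) = 2 * a j + L * θ j) :
    ∀ j, θ j ≤ (2 * Ca / (L * (L - 1))) * ε * x j := by
  have hL1 : 0 < L - 1 := by linarith
  have hL0 : 0 < L := by linarith
  intro j
  induction j with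
  | zero => rw [hθ0]; have := hx0 0; positivity
  | succ j ih =>
    rw [hθ, hx]
    have hxj := hx0 j
    have haj := ha j
    -- `2C_aεx + L·Dεx ≤ Dε L² x` since `2C_a + L D = D L²` for `D = 2C_a/(L(L−1))`
    have hD : 2 * Ca + L * (2 * Ca / (L * (L - 1))) = (2 * Ca / (L * (L - 1))) * L ^ 2 := by
      field_simp
      ring
    calc 2 * a j + L * θ j ≤ 2 * (Ca * ε * x j) + L * ((2 * Ca / (L * (L - 1))) * ε * x j) := by
          have := mul_le_mul_of_nonneg_left ih hL0.le
          linarith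
      _ = (2 * Ca + L * (2 * Ca / (L * (L - 1)))) * ε * x j := by ring
      _ = (2 * Ca / (L * (L - 1))) * ε * (L ^ 2 * x j) := by rw [hD]; ring

omit [NeZero n] in
/-- `η_0 = 0`, `η_{j+1} = Mθ_j + η_j`, `θ_j ≤ Dεx_j` ⇒ `η_j ≤ (MD/(L²−1))·ε·x_j`. [folklore] -/
theorem eta_bound {L M D ε : ℝ} (hL : 2 ≤ L) (hM : 0 ≤ M) (hD : 0 ≤ D) (hε : 0 ≤ ε) (x θ η : ℕ → ℝ) (hx0 : ∀ j, 0 ≤ x j) (hx : ∀ j, x (j + 1) = L ^ 2 * x j)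
    (hθb : ∀ j, θ j ≤ D * ε * x j) (hη0 : η 0 = 0) (hη : ∀ j, η (j + 1) = M * θ j + η j) :
    ∀ j, η j ≤ (M * D / (L ^ 2 - 1)) * ε * x j := by
  have hL2 : 0 < L ^ 2 - 1 := by nlinarith
  intro j
  induction j with
  | zero => rw [hη0]; have := hx0 0; positivity
  | succ j ih =>
    rw [hη, hx]
    have hE : M * D + M * D / (L ^ 2 - 1) = M * D / (L ^ 2 - 1) * L ^ 2 := by
      field_simp
      ring
    calc M * θ j + η j ≤ M * (D * ε * x j) + (M * D / (L ^ 2 - 1)) * ε * x j := add_le_add (mul_le_mul_of_nonneg_left (hθb j) hM) ih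
      _ = (M * D + M * D / (L ^ 2 - 1)) * ε * x j := by ring
      _ = (M * D / (L ^ 2 - 1)) * ε * (L ^ 2 * x j) := by rw [hE]; ring

omit [NeZero n] in
/-- `len_0 = 0`, `len_{j+1} = L^j·M + len_j` ⇒ `len_j ≤ 2M·L^j` (`L ≥ 2`; in fact `≤ M·L^j·L/(L−1)`). [folklore] -/
theorem len_bound {L M : ℕ} (hL : 2 ≤ L) (len : ℕ → ℕ) (h0 : len 0 = 0) (hs : ∀ j, len (j + 1) = L ^ j * M + len j) : ∀ j, len j ≤ 2 * M * L ^ j := by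
  intro j
  induction j with
  | zero => rw [h0]; exact Nat.zero_le _
  | succ j ih =>
    rw [hs, pow_succ]
    have : L ^ j * M + 2 * M * L ^ j ≤ 2 * M * (L ^ j * L) := by nlinarith [Nat.zero_le (M * L ^ j)]
    omega

/-! ## §3 ★★★ The pure `LINE`-iterate versus the engine functional, from the tower's geometric sizes -/

/-- ★★★ **`S_k` VERSUS THE ENGINE'S `A^{U₀}` FROM GEOMETRIC LEVEL SIZES, k-UNIFORM CONSTANTS.**  Tower `Ū₀^{(j)}`, `k ≤ m + K`; per-level loop sizes
`dist1(W^{(j)}_i(c)) ≤ C_a·ε·L^{2j}/L^{2k}` (`j < k`; e.g. from `PlaqSmall (εL^{−2k}) U₀` by ★routeR-w2's `tower_plaq_lt` ∘ `dist1_loopHol_le'` with `C_a = ((d+2)L)²/2`), `C_aε ≤ 1/6`,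
`C_aε < δ_N`, and `PlaqSmall δ U₀`.  Then for the pure `LINE` family `S` along the tower:
`Σ_c‖S k c − (L^k)^{−d}·Ad_{g_c}A^{U₀}_cY‖² ≤ ((2Eε + ((2(d+2)·L·L^k + (2d+1)L^k)²/2)δ)·(L^k)^{−d})²·((L^k)^d·L^k)·L^k·Σ_b‖Y_b‖²` with `E = (d+2)L·(2C_a/(L(L−1)))/(L²−1)`.
[cite: Balaban1985BackgroundPropagators, Thm 3.11 p.416; Balaban1984PropagatorsI, (1.18) p.20] -/
theorem sum_normSq_lineIter_sub_engine_le_of_tower {k : ℕ} (hk : k ≤ P.m + P.K) (U₀ : GaugeField P 0 (Matrix.specialUnitaryGroup (Fin n) ℂ))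
    (Y : PBond P 0 → Matrix (Fin n) (Fin n) ℂ) {Ca ε δ : ℝ} (hCa : 0 ≤ Ca) (hε : 0 ≤ ε) (hδ : 0 ≤ δ) (hU : PlaqSmall δ U₀)
    (hα : ∀ j < k, ∀ (c : PBond P (j + 1)) (i : Idx P),
        dist1 (loopHol (Averaging.iter (fun i => blockAvg (P := P) (j := i) (expMeanLogSU (n := Fin n))) j U₀) c i) ≤ Ca * ε * ((P.L : ℝ) ^ (2 * j) / (P.L : ℝ) ^ (2 * k)))
    (h6 : Ca * ε ≤ 1 / 6) (hN : Ca * ε < deltaSU (Fin n))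
    (S : (k : ℕ) → PBond P k → Matrix (Fin n) (Fin n) ℂ) (hS0 : ∀ b, S 0 b = Y b)
    (hSs : ∀ (k : ℕ) (c : PBond P (k + 1)), S (k + 1) c
      = ((Fintype.card (Idx P) : ℂ))⁻¹ • ∑ i : Idx P,
          ((holAt (Averaging.iter (fun i => blockAvg (P := P) (j := i) (expMeanLogSU (n := Fin n))) k U₀) (walk (emb c.src) (stairWord i.2.1 (off i.1))) :
              Matrix.specialUnitaryGroup (Fin n) ℂ) : Matrix (Fin n) (Fin n) ℂ) *
            covWalkSum (Averaging.iter (fun i => blockAvg (P := P) (j := i) (expMeanLogSU (n := Fin n))) k U₀) (S k)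
              (walk (walkEnd (emb c.src) (stairWord i.2.1 (off i.1))) (List.replicate P.L (c.dir, true))) *
          star ((holAt (Averaging.iter (fun i => blockAvg (P := P) (j := i) (expMeanLogSU (n := Fin n))) k U₀) (walk (emb c.src) (stairWord i.2.1 (off i.1))) :
              Matrix.specialUnitaryGroup (Fin n) ℂ) : Matrix (Fin n) (Fin n) ℂ)) :
    ∑ c : PBond P k, ‖S k c - (((P.L : ℂ) ^ k) ^ P.d)⁻¹ •
        (((holAt U₀ (walk (embIter k c.src) (treeWord fun _ : Fin P.d => -(((P.L ^ k - 1) / 2 : ℕ) : ℤ))) : Matrix.specialUnitaryGroup (Fin n) ℂ) : Matrix (Fin n) (Fin n) ℂ)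
          * (∑ r : Fin P.d → Fin (P.L ^ k), ∑ s ∈ Finset.range (P.L ^ k),
              conjR (holT (unitsField (toUField U₀)) (Site.fibreSite 0 k c.src fun _ => ⟨0, pow_pos P.L_pos k⟩) (treeWord fun ν => ((r ν : ℕ) : ℤ))
                  * holT (unitsField (toUField U₀)) (Site.fibreSite 0 k c.src r) (List.replicate s (c.dir, true)))
                (Y ⟨(fun z : Site P 0 => z.shift c.dir)^[s] (Site.fibreSite 0 k c.src r), c.dir⟩))
          * star (((holAt U₀ (walk (embIter k c.src) (treeWord fun _ : Fin P.d => -(((P.L ^ k - 1) / 2 : ℕ) : ℤ))) : Matrix.specialUnitaryGroup (Fin n) ℂ) :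
              Matrix (Fin n) (Fin n) ℂ)))‖ ^ 2
      ≤ ((2 * (((((P.d + 2) * P.L : ℕ) : ℝ)) * (2 * Ca / ((P.L : ℝ) * ((P.L : ℝ) - 1))) / ((P.L : ℝ) ^ 2 - 1)) * ε
            + ((((2 * ((P.d + 2) * P.L) * P.L ^ k + (2 * P.d + 1) * P.L ^ k : ℕ) : ℝ)) ^ 2 / 2) * δ) * (((P.L : ℝ) ^ k) ^ P.d)⁻¹) ^ 2
          * ((((P.L : ℝ) ^ k) ^ P.d * (P.L : ℝ) ^ k) * (P.L : ℝ) ^ k) * ∑ b : PBond P 0, ‖Y b‖ ^ 2 := by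
  have hL2 : (2 : ℝ) ≤ P.L := by exact_mod_cast P.hL.2
  have hL2n : 2 ≤ P.L := P.hL.2
  -- the per-level sizes and the dominating recursion families (no definitions: local recursions)
  let a : ℕ → ℝ := fun j => Ca * ε * ((P.L : ℝ) ^ (2 * j) / (P.L : ℝ) ^ (2 * k))
  let θ : ℕ → ℝ := fun j => Nat.rec 0 (fun j θj => 2 * a j + P.L * θj) j
  let η : ℕ → ℝ := fun j => Nat.rec 0 (fun j ηj => (((P.d + 2) * P.L : ℕ) : ℝ) * θ j + ηj) j
  let len : ℕ → ℕ := fun j => Nat.rec 0 (fun j lj => P.L ^ j * ((P.d + 2) * P.L) + lj) j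
  let H : ℕ → ℕ := fun j => (P.L ^ j - 1) / 2
  have hθ0 : θ 0 = 0 := rfl
  have hθs : ∀ j, θ (j + 1) = 2 * a j + P.L * θ j := fun _ => rfl
  have hη0 : η 0 = 0 := rfl
  have hηs : ∀ j, η (j + 1) = (((P.d + 2) * P.L : ℕ) : ℝ) * θ j + η j := fun _ => rfl
  have hlen0 : len 0 = 0 := rfl
  have hlens : ∀ j, len (j + 1) = P.L ^ j * ((P.d + 2) * P.L) + len j := fun _ => rfl
  have hH0 : H 0 = 0 := by simp [H]
  have hHs : ∀ j, H (j + 1) = (P.L - 1) / 2 * P.L ^ j + H j := fun j => half_pow_succ_sub_one j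
  -- sizes: nonnegative, ≤ C_aε (so ≤ 1/6 and < δ_N)
  have hx0 : ∀ j, 0 ≤ (P.L : ℝ) ^ (2 * j) / (P.L : ℝ) ^ (2 * k) := fun j => by positivity
  have hxs : ∀ j, (P.L : ℝ) ^ (2 * (j + 1)) / (P.L : ℝ) ^ (2 * k) = (P.L : ℝ) ^ 2 * ((P.L : ℝ) ^ (2 * j) / (P.L : ℝ) ^ (2 * k)) := fun j => by
    rw [show 2 * (j + 1) = 2 * j + 2 by ring, pow_add]; ring
  have ha0 : ∀ j, 0 ≤ a j := fun j => by positivity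
  have hale : ∀ j < k, a j ≤ Ca * ε := by
    intro j hj
    have hx1 : (P.L : ℝ) ^ (2 * j) / (P.L : ℝ) ^ (2 * k) ≤ 1 := by
      rw [div_le_one (by positivity)]
      exact pow_le_pow_right₀ (by linarith) (by omega)
    calc a j = Ca * ε * ((P.L : ℝ) ^ (2 * j) / (P.L : ℝ) ^ (2 * k)) := rfl
      _ ≤ Ca * ε * 1 := mul_le_mul_of_nonneg_left hx1 (by positivity)
      _ = Ca * ε := mul_one _
  -- θ ≥ 0 and the recursion (in)equalities
  have hθnn : ∀ j, 0 ≤ θ j := by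
    intro j; induction j with
    | zero => exact le_rfl
    | succ j ih => rw [hθs]; have := ha0 j; positivity
  -- closed-form bounds
  have hθb := theta_bound hL2 hCa hε a (fun j => (P.L : ℝ) ^ (2 * j) / (P.L : ℝ) ^ (2 * k)) θ hx0 hxs (fun j => le_rfl) hθ0 hθs
  have hD0 : 0 ≤ 2 * Ca / ((P.L : ℝ) * ((P.L : ℝ) - 1)) := by have : (0:ℝ) < (P.L : ℝ) - 1 := by linarith
                                                              positivity
  have hηb := eta_bound hL2 (M := (((P.d + 2) * P.L : ℕ) : ℝ)) (Nat.cast_nonneg _) hD0 hε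
    (fun j => (P.L : ℝ) ^ (2 * j) / (P.L : ℝ) ^ (2 * k)) θ η hx0 hxs hθb hη0 hηs
  have hlenb := len_bound hL2n len hlen0 hlens
  -- the representation
  obtain ⟨Ω, hΩ, τ, ρ, t, W, h1, h2, h3, h4, h5, h6'⟩ := exists_lineIter_repr U₀ Y S hS0 hSs a θ η len H hθnn (fun j => (hθs j).le) le_rfl
    (fun j => (hηs j).le) (fun j => (hlens j).le) hH0 hHs k hk hα (fun j hj => (hale j hj).trans h6) (fun j hj => (hale j hj).trans_lt hN)
  -- the invariant at `H k = (L^k−1)/2`, `η := η k ≤ Eε`, `Λ := len k ≤ 2(d+2)L·L^k`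
  have hηk : η k ≤ ((((P.d + 2) * P.L : ℕ) : ℝ)) * (2 * Ca / ((P.L : ℝ) * ((P.L : ℝ) - 1))) / ((P.L : ℝ) ^ 2 - 1) * ε := by
    have h := hηb k
    have hx1 : (P.L : ℝ) ^ (2 * k) / (P.L : ℝ) ^ (2 * k) = 1 := div_self (by positivity)
    rw [hx1, mul_one] at h
    exact h
  have hηnn : 0 ≤ η k := by
    have : ∀ j, 0 ≤ η j := by
      intro j; induction j with
      | zero => exact le_rfl
      | succ j ih => rw [hηs]; have := hθnn j; positivity
    exact this k
  have hmain := sum_normSq_lineIter_sub_engine_le hk U₀ Y hδ hU (S k) τ ρ t W hηnn (Λ := 2 * ((P.d + 2) * P.L) * P.L ^ k) h1 h2 h3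
    (fun c ω => (h4 c ω).trans (hlenb k)) h5 h6'
  refine hmain.trans ?_
  -- monotonicity of the constant in `η`
  have hS0 : 0 ≤ ((((P.L : ℝ) ^ k) ^ P.d * (P.L : ℝ) ^ k) * (P.L : ℝ) ^ k) * ∑ b : PBond P 0, ‖Y b‖ ^ 2 := by positivity
  have hc1 : 0 ≤ (2 * η k + ((((2 * ((P.d + 2) * P.L) * P.L ^ k + (2 * P.d + 1) * P.L ^ k : ℕ) : ℝ)) ^ 2 / 2) * δ) * (((P.L : ℝ) ^ k) ^ P.d)⁻¹ := by positivity
  have hc2 : (2 * η k + ((((2 * ((P.d + 2) * P.L) * P.L ^ k + (2 * P.d + 1) * P.L ^ k : ℕ) : ℝ)) ^ 2 / 2) * δ) * (((P.L : ℝ) ^ k) ^ P.d)⁻¹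
      ≤ (2 * (((((P.d + 2) * P.L : ℕ) : ℝ)) * (2 * Ca / ((P.L : ℝ) * ((P.L : ℝ) - 1))) / ((P.L : ℝ) ^ 2 - 1)) * ε
          + ((((2 * ((P.d + 2) * P.L) * P.L ^ k + (2 * P.d + 1) * P.L ^ k : ℕ) : ℝ)) ^ 2 / 2) * δ) * (((P.L : ℝ) ^ k) ^ P.d)⁻¹ :=
    mul_le_mul_of_nonneg_right (by linarith) (by positivity)
  have := mul_le_mul (pow_le_pow_left₀ hc1 hc2 2) le_rfl hS0 (by positivity)
  simpa only [mul_assoc] using this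

end Summit.QuantumFields.YangMills.Theorems.Prop7LineIterVsEngineOfTower

end
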